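import Summits.ResolutionOfSingularities.ResolutionOfSingularities.Theorems.MarkedTransferCampaignW46WWalkModel
import Mathlib.RingTheory.MvPowerSeries.Substitution
import Mathlib.Algebra.CharP.Algebra
import Mathlib.Algebra.CharP.Lemmas
import HarnessLib

/-!
# [OURS · L1 W4.6 rung (iii-2)] THE W-WALK: the coefficientwise operations ARE the honest substitutions of `K⟦t, y, z⟧`

Cell `res-hironaka`, LADDER-RESOLUTION rung L (D-0089), slot W4.6 rung (iii); seat res-L1-s46-pv-5 (gen 6), plan
`HOME/L/res-L1-s46-pv-5/W-WALK-PLAN.md` §3 [E]. Host route MarkedTransfer, `--supports stmt-ResolutionOfSingularities-16155 --as helper`;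
kind definition (the three substitution families).

WHAT. The bridge between the coefficient model `…WWalkModel` (where the LAWS live) and `MvPowerSeries.subst` (where res-L1-s46-pv-2's
formal chart recognition `WildConesCampaignW46FormalChart.exists_ringEquiv_chart` and the composite substitutions of the endgame live):
* `thetaT l` — the chart substitution `t ↦ t, y ↦ t(y + l), z ↦ tz` of the direction `(1 : l : 0)`; **`subst (thetaT l) f = t^p · chartT p l f`**
  for `f` of order `≥ p` (`subst_thetaT_eq`);
* `shearS γ` — `z ↦ z − γt`; **`subst (shearS γ) f = shearZ γ f`** (`subst_shearS_eq`);
* `swapS` — `t ↔ y`; **`subst swapS f = swapTY f`** (`subst_swapS_eq`).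
All three are `HasSubst` (constant coefficients `0`). Proofs: Mathlib `MvPowerSeries.coeff_subst` (a finite sum over the monomials of `f`
that can reach the target exponent) and the binomial theorem.

HONEST FRAMING. OURS; nothing here is a statement of H. Hironaka's manuscript [Hironaka2017] and nothing of it is used. AI-written;
AI review is weaker than expert review. No `sorry`; axioms standard. [folklore]; chart formulas as in [Hauser2010] §F.
-/

noncomputable section

set_option linter.dupNamespace false -- mandated namespace of this single-conjunct summit

open MvPowerSeries Finset

namespace Summit.ResolutionOfSingularities.ResolutionOfSingularities.Theorems

namespace CampaignW46

namespace WWalk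

variable {K : Type*} [Field K]

/-! ## §1 The three substitution families -/

/-- The chart substitution of the direction `(1 : l : 0)`: `t ↦ t`, `y ↦ t(y + l)`, `z ↦ tz`. [cite: Hauser2010, §F] -/
def thetaT (l : K) : Option (Fin 2) → MvPowerSeries (Option (Fin 2)) K :=
  fun o => Option.elim o (X (some 0) * X none) ![X (some 0), X (some 0) * (X (some 1) + C l)]

/-- The cleaning shear `z ↦ z − γt` (`t, y` fixed). [folklore] -/
def shearS (γ : K) : Option (Fin 2) → MvPowerSeries (Option (Fin 2)) K :=
  fun o => Option.elim o (X none - C γ * X (some 0)) ![X (some 0), X (some 1)]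

/-- The swap `t ↔ y` (`z` fixed). [folklore] -/
def swapS : Option (Fin 2) → MvPowerSeries (Option (Fin 2)) K :=
  fun o => Option.elim o (X none) ![X (some 1), X (some 0)]

/-- Value of the substitution family (simp). [folklore] -/
@[simp] theorem thetaT_none (l : K) : thetaT l none = X (some 0) * X none := rfl
/-- Value of the substitution family (simp). [folklore] -/
@[simp] theorem thetaT_zero (l : K) : thetaT l (some 0) = X (some 0) := rfl
/-- Value of the substitution family (simp). [folklore] -/
@[simp] theorem thetaT_one (l : K) : thetaT l (some 1) = X (some 0) * (X (some 1) + C l) := rfl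
/-- Value of the substitution family (simp). [folklore] -/
@[simp] theorem shearS_none (γ : K) : shearS γ none = X none - C γ * X (some 0) := rfl
/-- Value of the substitution family (simp). [folklore] -/
@[simp] theorem shearS_zero (γ : K) : shearS γ (some 0) = X (some 0) := rfl
/-- Value of the substitution family (simp). [folklore] -/
@[simp] theorem shearS_one (γ : K) : shearS γ (some 1) = X (some 1) := rfl
/-- Value of the substitution family (simp). [folklore] -/
@[simp] theorem swapS_none : (swapS (K := K)) none = X none := rfl
/-- Value of the substitution family (simp). [folklore] -/
@[simp] theorem swapS_zero : (swapS (K := K)) (some 0) = X (some 1) := rfl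
/-- Value of the substitution family (simp). [folklore] -/
@[simp] theorem swapS_one : (swapS (K := K)) (some 1) = X (some 0) := rfl

/-- `thetaT` is substitutable. [folklore] -/
theorem hasSubst_thetaT (l : K) : HasSubst (thetaT l) := by
  refine hasSubst_of_constantCoeff_zero fun o => ?_
  rcases o with _ | ⟨i, hi⟩
  · simp
  · interval_cases i
    · exact constantCoeff_X _
    · change constantCoeff (X (some 0) * (X (some 1) + C l) : MvPowerSeries (Option (Fin 2)) K) = 0
      simp

/-- `shearS` is substitutable. [folklore] -/
theorem hasSubst_shearS (γ : K) : HasSubst (shearS γ) := by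
  refine hasSubst_of_constantCoeff_zero fun o => ?_
  rcases o with _ | ⟨i, hi⟩
  · simp
  · interval_cases i
    · exact constantCoeff_X _
    · exact constantCoeff_X _

/-- `swapS` is substitutable. [folklore] -/
theorem hasSubst_swapS : HasSubst (swapS (K := K)) := by
  refine hasSubst_of_constantCoeff_zero fun o => ?_
  rcases o with _ | ⟨i, hi⟩
  · exact constantCoeff_X _
  · interval_cases i
    · exact constantCoeff_X _
    · exact constantCoeff_X _

/-! ## §2 Monomials and the generic coefficient-of-substitution formula -/

/-- `s · t^n y^i z^c` is the monomial `mk3 n i c`. [folklore] -/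
theorem C_mul_X_pow_eq_monomial (s : K) (n i c : ℕ) :
    (C s * X (some 0) ^ n * X (some 1) ^ i * X none ^ c : MvPowerSeries (Option (Fin 2)) K) = monomial (mk3 n i c) s := by
  rw [X_pow_eq, X_pow_eq, X_pow_eq, ← monomial_zero_eq_C_apply, monomial_mul_monomial, monomial_mul_monomial,
    monomial_mul_monomial, zero_add, mul_one, mul_one, mul_one]
  rfl

/-- The product `∏_s a_s^{d_s}` over the three letters. [folklore] -/
theorem prod_pow_eq (a : Option (Fin 2) → MvPowerSeries (Option (Fin 2)) K) (d : Option (Fin 2) →₀ ℕ) :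
    (d.prod fun s n => a s ^ n) = a (some 0) ^ d (some 0) * a (some 1) ^ d (some 1) * a none ^ d none := by
  rw [Finsupp.prod_pow, Fintype.prod_option, Fin.prod_univ_two]
  ring

/-- **Coefficients of a substitution as a finite sum** over any finset of source exponents outside which the terms vanish. [folklore] -/
theorem coeff_subst_eq_sum {a : Option (Fin 2) → MvPowerSeries (Option (Fin 2)) K} (ha : HasSubst a)
    (f : MvPowerSeries (Option (Fin 2)) K) (e : Option (Fin 2) →₀ ℕ) (S : Finset (Option (Fin 2) →₀ ℕ))
    (hS : ∀ d, coeff d f • coeff e (d.prod fun s n => a s ^ n) ≠ 0 → d ∈ S) :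
    coeff e (subst a f) = ∑ d ∈ S, coeff d f • coeff e (d.prod fun s n => a s ^ n) := by
  rw [coeff_subst ha]
  exact finsum_eq_finsetSum_of_support_subset _ (fun d hd => by exact_mod_cast hS d hd)

/-! ## §3 The swap -/

/-- **`subst swapS f = swapTY f`.** [folklore] -/
theorem subst_swapS_eq (f : MvPowerSeries (Option (Fin 2)) K) : subst swapS f = swapTY f := by
  classical
  ext e
  have hP : ∀ d : Option (Fin 2) →₀ ℕ, (d.prod fun s n => (swapS (K := K)) s ^ n) = monomial (mk3 (d (some 1)) (d (some 0)) (d none)) 1 := by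
    intro d
    rw [prod_pow_eq, swapS_zero, swapS_one, swapS_none, ← C_mul_X_pow_eq_monomial, map_one, one_mul]
    ring
  rw [coeff_subst_eq_sum hasSubst_swapS f e {mk3 (e (some 1)) (e (some 0)) (e none)}]
  · rw [sum_singleton, hP, coeff_monomial, mk3_t, mk3_y, mk3_z, if_pos (mk3_eta e).symm, smul_eq_mul, mul_one]
    conv_rhs => rw [← mk3_eta e, coeff_swapTY]
  · intro d hd
    rw [hP, coeff_monomial] at hd
    rw [mem_singleton]
    by_cases h : e = mk3 (d (some 1)) (d (some 0)) (d none)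
    · have h1 := congrArg (fun x => x (some 0)) h
      have h2 := congrArg (fun x => x (some 1)) h
      have h3 := congrArg (fun x => x none) h
      simp only [mk3_t, mk3_y, mk3_z] at h1 h2 h3
      rw [← mk3_eta d, mk3_inj]; omega
    · rw [if_neg h, smul_zero] at hd; exact absurd rfl hd

/-! ## §4 The cleaning shear -/

/-- The monomial products of `shearS γ`: `t^a y^b (z − γt)^c = Σ_{m ≤ c} C(c,m) (−γ)^{c−m} · t^{a+c−m} y^b z^m`. [folklore] -/
theorem prod_pow_shearS (γ : K) (d : Option (Fin 2) →₀ ℕ) :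
    (d.prod fun s n => shearS γ s ^ n) = ∑ m ∈ range (d none + 1),
      monomial (mk3 (d (some 0) + (d none - m)) (d (some 1)) m) (((d none).choose m : K) * (-γ) ^ (d none - m)) := by
  rw [prod_pow_eq, shearS_zero, shearS_one, shearS_none, sub_eq_add_neg, add_pow, mul_sum]
  refine sum_congr rfl fun m hm => ?_
  rw [← C_mul_X_pow_eq_monomial, map_mul, map_pow, map_neg, map_natCast,
    show (-(C γ * X (some 0)) : MvPowerSeries (Option (Fin 2)) K) = (-C γ) * X (some 0) by ring, mul_pow, pow_add]
  ring

/-- **`subst (shearS γ) f = shearZ γ f`.** [folklore] -/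
theorem subst_shearS_eq (γ : K) (f : MvPowerSeries (Option (Fin 2)) K) : subst (shearS γ) f = shearZ γ f := by
  classical
  ext e
  -- coefficient of `e` in the monomial product of `d`
  have hP : ∀ d : Option (Fin 2) →₀ ℕ, coeff e (d.prod fun s n => shearS γ s ^ n) =
      ∑ m ∈ range (d none + 1), if e = mk3 (d (some 0) + (d none - m)) (d (some 1)) m then
        ((d none).choose m : K) * (-γ) ^ (d none - m) else 0 := by
    intro d
    rw [prod_pow_shearS, map_sum]
    exact sum_congr rfl fun m _ => by rw [coeff_monomial]
  rw [coeff_subst_eq_sum (hasSubst_shearS γ) f e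
    ((range (e (some 0) + 1)).image fun i => mk3 (e (some 0) - i) (e (some 1)) (e none + i))]
  · rw [sum_image (fun i _ j _ h => by have := (mk3_inj.mp h).2.2; omega)]
    conv_rhs => rw [← mk3_eta e, coeff_shearZ]
    refine sum_congr rfl fun i hi => ?_
    rw [mem_range] at hi
    rw [hP, smul_eq_mul]
    simp only [mk3_t, mk3_y, mk3_z]
    rw [sum_eq_single (e none)]
    · have hcond : e = mk3 (e (some 0) - i + (e none + i - e none)) (e (some 1)) (e none) := by
        conv_lhs => rw [← mk3_eta e]
        exact mk3_inj.mpr ⟨by omega, rfl, rfl⟩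
      rw [if_pos hcond, show e none + i - e none = i by omega, Nat.choose_symm_of_eq_add rfl]
      ring
    · intro m hm hne
      rw [if_neg]
      intro h
      have := congrArg (fun x => x none) h
      simp only [mk3_z] at this
      exact hne this.symm
    · intro h; exact absurd (mem_range.mpr (by omega)) h
  · intro d hd
    rw [hP] at hd
    obtain ⟨m, hm, hne⟩ := exists_ne_zero_of_sum_ne_zero (by
      intro h0; rw [h0, smul_zero] at hd; exact hd rfl)
    rw [mem_range] at hm
    have h : e = mk3 (d (some 0) + (d none - m)) (d (some 1)) m := by
      by_contra h; rw [if_neg h] at hne; exact hne rfl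
    have h1 := congrArg (fun x => x (some 0)) h
    have h2 := congrArg (fun x => x (some 1)) h
    have h3 := congrArg (fun x => x none) h
    simp only [mk3_t, mk3_y, mk3_z] at h1 h2 h3
    rw [mem_image]
    refine ⟨d none - m, mem_range.mpr (by omega), ?_⟩
    conv_rhs => rw [← mk3_eta d]
    exact mk3_inj.mpr ⟨by omega, by omega, by omega⟩

/-! ## §5 The chart substitution of the direction `(1 : l : 0)` -/

/-- The monomial products of `thetaT l`: `t^a (t(y+l))^b (tz)^c = Σ_{m ≤ b} C(b,m) l^{b−m} · t^{a+b+c} y^m z^c`. [cite: Hauser2010, §F] -/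
theorem prod_pow_thetaT (l : K) (d : Option (Fin 2) →₀ ℕ) :
    (d.prod fun s n => thetaT l s ^ n) = ∑ m ∈ range (d (some 1) + 1),
      monomial (mk3 (d (some 0) + d (some 1) + d none) m (d none)) (((d (some 1)).choose m : K) * l ^ (d (some 1) - m)) := by
  rw [prod_pow_eq, thetaT_zero, thetaT_one, thetaT_none, mul_pow, add_pow, mul_sum, mul_sum, sum_mul]
  refine sum_congr rfl fun m hm => ?_
  rw [← C_mul_X_pow_eq_monomial, map_mul, map_pow, map_natCast, mul_pow, pow_add, pow_add]
  ring

/-- **`subst (thetaT l) f = t^p · chartT p l f`** for `f` of order `≥ p`. [cite: Hauser2010, §F] -/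
theorem subst_thetaT_eq {p : ℕ} (l : K) {f : MvPowerSeries (Option (Fin 2)) K} (hf : LowVanish p f) :
    subst (thetaT l) f = X (some 0) ^ p * chartT p l f := by
  classical
  ext e
  have hP : ∀ d : Option (Fin 2) →₀ ℕ, coeff e (d.prod fun s n => thetaT l s ^ n) =
      ∑ m ∈ range (d (some 1) + 1), if e = mk3 (d (some 0) + d (some 1) + d none) m (d none) then
        ((d (some 1)).choose m : K) * l ^ (d (some 1) - m) else 0 := by
    intro d
    rw [prod_pow_thetaT, map_sum]
    exact sum_congr rfl fun m _ => by rw [coeff_monomial]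
  -- the left-hand side as a sum over `b = d_y`
  have hL : coeff e (subst (thetaT l) f) = ∑ b ∈ range (e (some 0) + 1),
      if b + e none ≤ e (some 0) then
        coeff (mk3 (e (some 0) - b - e none) b (e none)) f * ((b.choose (e (some 1)) : K) * l ^ (b - e (some 1))) else 0 := by
    rw [coeff_subst_eq_sum (hasSubst_thetaT l) f e
      ((range (e (some 0) + 1)).image fun b => mk3 (e (some 0) - b - e none) b (e none))]
    · rw [sum_image (fun i _ j _ h => by exact (mk3_inj.mp h).2.1)]
      refine sum_congr rfl fun b hb => ?_
      rw [mem_range] at hb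
      rw [hP, smul_eq_mul]
      simp only [mk3_t, mk3_y, mk3_z]
      by_cases hguard : b + e none ≤ e (some 0)
      · rw [if_pos hguard, sum_eq_single (e (some 1))]
        · by_cases hey : e (some 1) ≤ b
          · rw [if_pos]
            conv_lhs => rw [← mk3_eta e]
            exact mk3_inj.mpr ⟨by omega, rfl, rfl⟩
          · rw [Nat.choose_eq_zero_of_lt (by omega), Nat.cast_zero, zero_mul, ite_self]
        · intro m hm hne
          rw [if_neg]
          intro h
          have := congrArg (fun x => x (some 1)) h
          simp only [mk3_y] at this
          exact hne this.symm
        · intro h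
          rw [mem_range, not_lt] at h
          rw [Nat.choose_eq_zero_of_lt (by omega), Nat.cast_zero, zero_mul, ite_self]
      · rw [if_neg hguard]
        refine mul_eq_zero_of_right _ (sum_eq_zero fun m hm => ?_)
        rw [if_neg]
        intro h
        have := congrArg (fun x => x (some 0)) h
        simp only [mk3_t] at this
        omega
    · intro d hd
      rw [hP] at hd
      obtain ⟨m, hm, hne⟩ := exists_ne_zero_of_sum_ne_zero (by
        intro h0; rw [h0, smul_zero] at hd; exact hd rfl)
      have h : e = mk3 (d (some 0) + d (some 1) + d none) m (d none) := by
        by_contra h; rw [if_neg h] at hne; exact hne rfl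
      have h1 := congrArg (fun x => x (some 0)) h
      have h2 := congrArg (fun x => x (some 1)) h
      have h3 := congrArg (fun x => x none) h
      simp only [mk3_t, mk3_y, mk3_z] at h1 h2 h3
      rw [mem_image]
      refine ⟨d (some 1), mem_range.mpr (by omega), ?_⟩
      conv_rhs => rw [← mk3_eta d]
      exact mk3_inj.mpr ⟨by omega, rfl, by omega⟩
  rw [hL, X_pow_eq, coeff_monomial_mul]
  by_cases hp : Finsupp.single (some 0) p ≤ e
  · rw [if_pos hp, one_mul]
    have hpe : p ≤ e (some 0) := by have := hp (some 0); simpa using this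
    have hsub : e - Finsupp.single (some 0) p = mk3 (e (some 0) - p) (e (some 1)) (e none) := by
      ext o; rcases o with _ | ⟨i, hi⟩
      · simp [mk3]
      · interval_cases i <;> simp [mk3]
    rw [hsub, coeff_chartT, show e (some 0) - p + p = e (some 0) by omega]
    refine sum_congr rfl fun b hb => ?_
    split_ifs with h
    · ring
    · rfl
  · rw [if_neg hp]
    have hpe : e (some 0) < p := by
      rw [Finsupp.single_le_iff] at hp; push Not at hp; exact hp
    refine sum_eq_zero fun b hb => ?_
    split_ifs with h
    · rw [hf _ (by rw [degree_mk3]; omega), zero_mul]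
    · rfl

/-! ## §6 The two corollaries the formal step consumes -/

/-- **The chart substitution on the generator**: `(z^p + f)(t, t(y+l), tz) = t^p · (z^p + chartT p l f)` for `f` of order `≥ p`.
[cite: Hauser2010, §F] -/
theorem subst_thetaT_generator {p : ℕ} (l : K) {f : MvPowerSeries (Option (Fin 2)) K} (hf : LowVanish p f) :
    subst (thetaT l) (X none ^ p + f) = X (some 0) ^ p * (X none ^ p + chartT p l f) := by
  rw [subst_add (hasSubst_thetaT l), subst_pow (hasSubst_thetaT l), subst_X (hasSubst_thetaT l), thetaT_none,
    subst_thetaT_eq l hf]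
  ring

/-- **The cleaning shear on the transformed generator** (characteristic `p`): `(z − γt)^p + (chartT p l f)(t, y, z − γt) =
z^p + stepT p l γ f`. [cite: Hauser2010, §G] -/
theorem subst_shearS_generator {p : ℕ} [Fact p.Prime] [CharP K p] (l γ : K) (f : MvPowerSeries (Option (Fin 2)) K) :
    subst (shearS γ) (X none ^ p + chartT p l f) = X none ^ p + stepT p l γ f := by
  haveI : CharP (MvPowerSeries (Option (Fin 2)) K) p := charP_of_injective_ringHom (MvPowerSeries.C_injective) p
  have hsh : ∀ h : MvPowerSeries (Option (Fin 2)) K, shearZ γ h = subst (shearS γ) h := fun h => (subst_shearS_eq γ h).symm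
  rw [subst_add (hasSubst_shearS γ), subst_pow (hasSubst_shearS γ), subst_X (hasSubst_shearS γ), shearS_none, sub_pow_char,
    stepT, hsh, subst_sub (hasSubst_shearS γ), subst_mul (hasSubst_shearS γ), subst_pow (hasSubst_shearS γ),
    subst_X (hasSubst_shearS γ), shearS_zero, subst_C, mul_pow, ← map_pow]
  ring

end WWalk

end CampaignW46

end Summit.ResolutionOfSingularities.ResolutionOfSingularities.Theorems

end
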